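import Literature.Computation.FiniteGraph.SAWLatticeDomains
import Literature.Probability.RandomPlanarGeometry.SAWLowerBound
import Literature.Probability.RandomPlanarGeometry.SAWFiniteMemory16
import HarnessLib

/-!
# Finite-graph witness engine, IX (computational): the sharp interval `x_c ∈ [200/539, 5/13]`

Topic `Literature/Computation/FiniteGraph`; everything proved, no facts — but COMPUTATIONAL: the
tree's certified bounds `2.6 ≤ μ(ℤ²)` (`SAW.le_connectiveConstant_26`, Kesten's irreducible bridges
through the strip transfer matrices) and `μ(ℤ²) ≤ 2.695` (`SAW.connectiveConstant_le_2695`, the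
memory-16 Pönitz–Tittmann automaton) are evaluated by `native_decide`, so every declaration of this
file inherits their `Lean.ofReduceBool` auxiliary axioms. It is kept apart from the axiom-clean parts
V–VIII for that reason.

* `criticalFugacity_mem_Icc_sharp`: `200/539 = 1/2.695 ≤ x_c ≤ 1/2.6 = 5/13`;
* `weight_mul_weight_lt_of_posCert_sharp`, `box_weight_mul_weight_lt_of_posCert_sharp`,
  `box_weight_avoids_mul_lt_of_posCert_sharp` — the product-inequality certificates of parts VII–VIII
  on this interval (needed from the `5 × 5` box on, where the differences change sign inside
  `[1/3, 1/2]`).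

## References
* N. Madras, G. Slade, *The Self-Avoiding Walk*, Birkhäuser 1993, §1.2 [MadrasSlade1993].
-/

noncomputable section

namespace Literature.Computation.FiniteGraph

open MeasureTheory Literature.Probability.LatticeModels Literature.Probability.RandomPlanarGeometry
open Literature.Probability.RandomPlanarGeometry.SAW.FiniteMemory (toPair toPair_injective)
open scoped ENNReal

/-- `x_c ∈ [200/539, 5/13] = [1/2.695, 1/2.6]`, from the tree's certified bounds `2.6 ≤ μ(ℤ²) ≤ 2.695`
(COMPUTATIONAL: inherits their `native_decide` auxiliary axioms). [cite: MadrasSlade1993, §1.2] -/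
theorem criticalFugacity_mem_Icc_sharp :
    (((200 : ℚ) / 539 : ℚ) : ℝ) ≤ SAW.criticalFugacity ∧ SAW.criticalFugacity ≤ (((5 : ℚ) / 13 : ℚ) : ℝ) := by
  have hlo := SAW.le_connectiveConstant_26
  have hhi := SAW.connectiveConstant_le_2695
  have hpos : 0 < SAW.connectiveConstant := by linarith
  constructor
  · rw [SAW.criticalFugacity]
    have : (((200 : ℚ) / 539 : ℚ) : ℝ) = 1 / 2.695 := by norm_num
    rw [this, inv_eq_one_div]
    exact one_div_le_one_div_of_le hpos hhi
  · rw [SAW.criticalFugacity]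
    have : (((5 : ℚ) / 13 : ℚ) : ℝ) = 1 / 2.6 := by norm_num
    rw [this, inv_eq_one_div]
    exact one_div_le_one_div_of_le (by norm_num) hlo

/-- Part VII's product certificate on the sharp interval (COMPUTATIONAL). [folklore] -/
theorem weight_mul_weight_lt_of_posCert_sharp {Ω : Set ℂ} {δ : ℝ} {S : List (ℤ × ℤ)}
    (hG : ∀ x y : Site 2, (discreteDomainGraph Ω δ).Adj x y ↔ (zdGraph 2).Adj x y ∧ toPair x ∈ S ∧ toPair y ∈ S)
    (a₁ b₁ a₂ b₂ a₃ b₃ a₄ b₄ : Site 2) {d : ℕ}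
    (h : posCert (psub (pmul (sawPoly S a₃ b₃) (sawPoly S a₄ b₄)) (pmul (sawPoly S a₁ b₁) (sawPoly S a₂ b₂)))
      d (200 / 539) (5 / 13) = true) :
    SAW.weight Ω δ a₁ b₁ Set.univ * SAW.weight Ω δ a₂ b₂ Set.univ <
      SAW.weight Ω δ a₃ b₃ Set.univ * SAW.weight Ω δ a₄ b₄ Set.univ :=
  weight_mul_weight_lt_of_posCert hG a₁ b₁ a₂ b₂ a₃ b₃ a₄ b₄
    criticalFugacity_mem_Icc_sharp.1 criticalFugacity_mem_Icc_sharp.2 h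

/-- Part VIII's box certificate on the sharp interval (COMPUTATIONAL). [folklore] -/
theorem box_weight_mul_weight_lt_of_posCert_sharp (a b a₁ b₁ a₂ b₂ a₃ b₃ a₄ b₄ : Site 2) {d : ℕ}
    (h : posCert (psub (pmul (sawPoly (boxList (toPair a) (toPair b)) a₃ b₃) (sawPoly (boxList (toPair a) (toPair b)) a₄ b₄))
      (pmul (sawPoly (boxList (toPair a) (toPair b)) a₁ b₁) (sawPoly (boxList (toPair a) (toPair b)) a₂ b₂)))
      d (200 / 539) (5 / 13) = true) :
    SAW.weight (siteDomain (boxSites a b)) 1 a₁ b₁ Set.univ * SAW.weight (siteDomain (boxSites a b)) 1 a₂ b₂ Set.univ <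
      SAW.weight (siteDomain (boxSites a b)) 1 a₃ b₃ Set.univ * SAW.weight (siteDomain (boxSites a b)) 1 a₄ b₄ Set.univ :=
  box_weight_mul_weight_lt_of_posCert a b a₁ b₁ a₂ b₂ a₃ b₃ a₄ b₄
    criticalFugacity_mem_Icc_sharp.1 criticalFugacity_mem_Icc_sharp.2 h

/-- Part VIII's hull-avoidance box certificate on the sharp interval (COMPUTATIONAL). [folklore] -/
theorem box_weight_avoids_mul_lt_of_posCert_sharp (a b a₁ b₁ a₂ b₂ a₃ b₃ a₄ b₄ : Site 2)
    (V₁ V₂ V₃ V₄ : List (ℤ × ℤ)) (h₁ : toPair a₁ ∉ V₁) (h₂ : toPair a₂ ∉ V₂) (h₃ : toPair a₃ ∉ V₃)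
    (h₄ : toPair a₄ ∉ V₄) {d : ℕ}
    (h : posCert (psub (pmul (sawPolyAvoiding (boxList (toPair a) (toPair b)) V₃ a₃ b₃)
        (sawPolyAvoiding (boxList (toPair a) (toPair b)) V₄ a₄ b₄))
      (pmul (sawPolyAvoiding (boxList (toPair a) (toPair b)) V₁ a₁ b₁)
        (sawPolyAvoiding (boxList (toPair a) (toPair b)) V₂ a₂ b₂))) d (200 / 539) (5 / 13) = true) :
    SAW.weight (siteDomain (boxSites a b)) 1 a₁ b₁ (avoids a₁ b₁ V₁) *
        SAW.weight (siteDomain (boxSites a b)) 1 a₂ b₂ (avoids a₂ b₂ V₂) <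
      SAW.weight (siteDomain (boxSites a b)) 1 a₃ b₃ (avoids a₃ b₃ V₃) *
        SAW.weight (siteDomain (boxSites a b)) 1 a₄ b₄ (avoids a₄ b₄ V₄) :=
  box_weight_avoids_mul_lt_of_posCert a b a₁ b₁ a₂ b₂ a₃ b₃ a₄ b₄ V₁ V₂ V₃ V₄ h₁ h₂ h₃ h₄
    criticalFugacity_mem_Icc_sharp.1 criticalFugacity_mem_Icc_sharp.2 h

end Literature.Computation.FiniteGraph
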